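import Literature.Probability.Percolation.LongRangeOneDim
import Literature.Probability.Percolation.PercolationProofs
import Mathlib.Data.Finset.Sym
import Mathlib.Data.Int.Interval
import HarnessLib

/-!
# Long-range bond percolation on `ℤ`: good blocks and the merging of their big clusters

Topic `Literature/Probability/Percolation`. The configuration-wise (measure-free) combinatorics
behind the renormalisation proof of the **existence of a percolation transition** in
one-dimensional `1/|x-y|²` models (Newman–Schulman 1986), in the form given by Duminil-Copin,
Garban and Tassion (*Long-range models in 1D revisited*, Ann. Inst. H. Poincaré Probab.
Statist. 60 (2024), arXiv:2011.04642, §2.2–§2.3, Lemma 2 and the proof of Thm. 1(i)):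

* `K`-blocks `B^i_K = [K(i-1), K(i+1))` ("consecutive blocks `B^i_K` and `B^{i+1}_K` are
  overlapping on half of their length. This will be a key property");
* clusters **in** a vertex set `S` ("a connected component of the graph with vertex set `S`
  and open edges with both endpoints in `S`"), here `locCluster ω E S x` = the trace on the
  finite set `S` of the tree's open cluster `openCluster (ω ∩ E) x` of the configuration
  restricted to the edge set `E` (for a loopless `E` this is `S ∩ openClusterIn (fromEdgeSet E) ω x`
  in the notation of `ConstrainedClusters.lean`, which is not imported here to keep the import
  closure small), and the block cluster `blkCluster ω K i x` (`E = (B^i_K).sym2`, Mathlib's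
  `Finset.sym2` = the edges with both endpoints in the block);
* `θ`-good blocks ("there exists a cluster in it of cardinality at least `2θK`") and `θ`-bad
  blocks, as events `good K θ i`, `bad K θ i ⊆ BondConfig ℤ`, determined by the finitely many
  edges inside the block (hence measurable);
* the **merging lemma** `exists_mem_blkCluster_inter` ("`𝐂(B^i_K)` has size at least `2θK`
  when the block is `θ`-good, and … when `θ > 3/4` … the overlapping property between
  subsequent `K`-blocks guarantees that all the clusters `𝐂(B^j_K)` are connected together"):
  for `θ > 3/4`, big clusters of two consecutive blocks share a vertex;
* the **chain lemma** `reachable_of_good_chain` and the size bound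
  `card_locCluster_ge_of_good_chain`: along a run of consecutive good blocks the chosen big
  clusters are all joined inside any edge set containing the block edges, and the resulting
  cluster contains the (pairwise disjoint) big clusters of every other block.

The probabilistic half (independence of disjoint blocks, the conditioning on `𝐂⁻, 𝐂⁺`, the
multi-scale induction) is in the companions under `Literature/Barriers/CriticalPhenomena/`
(`LongRangeDiscontinuity*`), where the model `longRangePercolation` lives.

Conventions: `K : ℕ` (block half-length), block indices `i j : ℤ`, densities `θ : ℝ`; all
clusters are `Finset ℤ` (classical decidability), sizes are compared in `ℝ` (`2 * θ * K ≤ #C`).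

## References

* H. Duminil-Copin, C. Garban, V. Tassion, *Long-range models in 1D revisited*, Ann. Inst.
  H. Poincaré Probab. Statist. 60 (2024) 232–241, arXiv:2011.04642: §2.2 (blocks, good
  blocks), §2.3 (Lemma 2, proof of Thm. 1(i)).
* C. M. Newman, L. S. Schulman, *One-dimensional `1/|j-i|^s` percolation models: the existence
  of a transition for `s ≤ 2`*, Comm. Math. Phys. 104 (1986) 547–571.
-/

noncomputable section

open scoped Classical

namespace Literature.Probability.Percolation

open SimpleGraph Finset

/-! ### Local clusters -/

/-- Walking along open edges with both endpoints in `S` (edges of `E ⊆ S.sym2`, Mathlib's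
`Set.sym2`) never leaves `S`. [folklore] -/
theorem mem_of_reachable_sym2 {ω : BondConfig ℤ} {E : Set (Sym2 ℤ)} {S : Set ℤ}
    (hE : E ⊆ S.sym2) {x y : ℤ} (h : (openGraph (ω ∩ E)).Reachable x y) (hx : x ∈ S) :
    y ∈ S := by
  refine h.some.mem_of_edges_closed hx fun a b hab _ => ?_
  have hadj := h.some.adj_of_mem_edges hab
  rw [openGraph_adj] at hadj
  exact (Set.mk_mem_sym2_iff.1 (hE hadj.1.2)).2

/-- **The cluster of `x` in `S` through `E`**: the vertices of the finite set `S` in the open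
cluster `openCluster (ω ∩ E) x` of `x` for the configuration restricted to the edge set `E`
(DGT: "a cluster in `S`" when `E = S.sym2`). [cite: DuminilcopinGarbanTassion2024, §2.2 (clusters in S)] -/
def locCluster (ω : BondConfig ℤ) (E : Set (Sym2 ℤ)) (S : Finset ℤ) (x : ℤ) : Finset ℤ :=
  S.filter (· ∈ openCluster (ω ∩ E) x)

/-- Membership in a local cluster: `y ∈ S` is joined to `x` by open edges of `E`. [folklore] -/
theorem mem_locCluster {ω : BondConfig ℤ} {E : Set (Sym2 ℤ)} {S : Finset ℤ} {x y : ℤ} :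
    y ∈ locCluster ω E S x ↔ y ∈ S ∧ (openGraph (ω ∩ E)).Reachable x y := by
  simp [locCluster, openCluster]

/-- A local cluster lies in its vertex set. [folklore] -/
theorem locCluster_subset (ω : BondConfig ℤ) (E : Set (Sym2 ℤ)) (S : Finset ℤ) (x : ℤ) :
    locCluster ω E S x ⊆ S :=
  Finset.filter_subset _ _

/-- `x` belongs to its own cluster in `S` as soon as `x ∈ S`. [folklore] -/
theorem mem_locCluster_self {ω : BondConfig ℤ} {E : Set (Sym2 ℤ)} {S : Finset ℤ} {x : ℤ}
    (hx : x ∈ S) : x ∈ locCluster ω E S x :=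
  Finset.mem_filter.2 ⟨hx, mem_openCluster_self _ x⟩

/-- Local clusters grow with the configuration, the edge set and the vertex set
(`openCluster_mono`). [folklore] -/
theorem locCluster_mono {ω ω' : BondConfig ℤ} {E E' : Set (Sym2 ℤ)} {S S' : Finset ℤ}
    (hω : ω ⊆ ω') (hE : E ⊆ E') (hS : S ⊆ S') (x : ℤ) :
    locCluster ω E S x ⊆ locCluster ω' E' S' x := fun y hy => by
  rw [locCluster, Finset.mem_filter] at hy ⊢
  exact ⟨hS hy.1, openCluster_mono (Set.inter_subset_inter hω hE) x hy.2⟩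

/-- Local clusters only see the edges of `E`: `ω` and `ω ∩ F` have the same `E`-clusters when
`E ⊆ F`. [folklore] -/
theorem locCluster_inter_eq {ω : BondConfig ℤ} {E F : Set (Sym2 ℤ)} (hEF : E ⊆ F)
    (S : Finset ℤ) (x : ℤ) : locCluster (ω ∩ F) E S x = locCluster ω E S x := by
  unfold locCluster
  rw [Set.inter_assoc, Set.inter_eq_right.2 hEF]

/-- Two vertices of one local cluster have the same local cluster (reachability is an
equivalence relation). [folklore] -/
theorem locCluster_eq_of_mem {ω : BondConfig ℤ} {E : Set (Sym2 ℤ)} {S : Finset ℤ} {x y : ℤ}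
    (hy : y ∈ locCluster ω E S x) : locCluster ω E S y = locCluster ω E S x := by
  ext z
  rw [mem_locCluster, mem_locCluster]
  have hxy := (mem_locCluster.1 hy).2
  exact ⟨fun ⟨hz, hr⟩ => ⟨hz, hxy.trans hr⟩, fun ⟨hz, hr⟩ => ⟨hz, hxy.symm.trans hr⟩⟩

/-! ### Blocks -/

/-- **The `K`-block `B^i_K = [K(i-1), K(i+1))`** (`2K` sites; consecutive blocks overlap on
half of their length). [cite: DuminilcopinGarbanTassion2024, §2.2 (K-blocks)] -/
def blk (K : ℕ) (i : ℤ) : Finset ℤ := Finset.Ico ((K : ℤ) * (i - 1)) ((K : ℤ) * (i + 1))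

/-- Membership in a block. [folklore] -/
@[simp] theorem mem_blk {K : ℕ} {i x : ℤ} : x ∈ blk K i ↔ (K : ℤ) * (i - 1) ≤ x ∧ x < (K : ℤ) * (i + 1) := by
  simp [blk]

/-- A block has `2K` sites. [cite: DuminilcopinGarbanTassion2024, §2.2] -/
theorem card_blk (K : ℕ) (i : ℤ) : (blk K i).card = 2 * K := by
  rw [blk, Int.card_Ico]
  have : (K : ℤ) * (i + 1) - (K : ℤ) * (i - 1) = ((2 * K : ℕ) : ℤ) := by push_cast; ring
  rw [this, Int.toNat_natCast]

/-- Blocks whose indices differ by at least `2` are disjoint. [folklore] -/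
theorem disjoint_blk {K : ℕ} {i j : ℤ} (h : i + 2 ≤ j) : Disjoint (blk K i) (blk K j) := by
  rw [Finset.disjoint_left]
  intro x hx hx'
  rw [mem_blk] at hx hx'
  nlinarith [hx.2, hx'.1, Int.natCast_nonneg K]

/-- The `K`-blocks `B^j_K`, `|j| ≤ C - 1`, lie in the big block `B_{CK} = B^0_{CK}`.
[cite: DuminilcopinGarbanTassion2024, §2.3 (proof of Lemma 2)] -/
theorem blk_subset_blk_mul {K C : ℕ} {j : ℤ} (hj₁ : -(C : ℤ) + 1 ≤ j) (hj₂ : j ≤ (C : ℤ) - 1) :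
    blk K j ⊆ blk (C * K) 0 := by
  intro x hx
  rw [mem_blk] at hx ⊢
  push_cast
  constructor <;> nlinarith [hx.1, hx.2, Int.natCast_nonneg K]

/-- The edges with both endpoints in the block `B^i_K`: Mathlib's `(B^i_K).sym2`, as a set of
edges. [cite: DuminilcopinGarbanTassion2024, §2.2] -/
abbrev blkEdges (K : ℕ) (i : ℤ) : Set (Sym2 ℤ) := ↑(blk K i).sym2

/-- Membership of a concrete edge in the block edge set. [folklore] -/
theorem mk_mem_blkEdges {K : ℕ} {i x y : ℤ} : s(x, y) ∈ blkEdges K i ↔ x ∈ blk K i ∧ y ∈ blk K i := by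
  rw [Finset.mem_coe, Finset.mk_mem_sym2_iff]

/-- Block edge sets are finite. [folklore] -/
theorem blkEdges_finite (K : ℕ) (i : ℤ) : (blkEdges K i).Finite :=
  (blk K i).sym2.finite_toSet

/-- **The cluster of `x` in the block `B^i_K`** (through the edges `(B^i_K).sym2`, among the sites
of the block; empty if `x ∉ B^i_K`). [cite: DuminilcopinGarbanTassion2024, §2.2] -/
abbrev blkCluster (ω : BondConfig ℤ) (K : ℕ) (i : ℤ) (x : ℤ) : Finset ℤ :=
  locCluster ω (blkEdges K i) (blk K i) x

/-! ### Good and bad blocks -/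

/-- **`B^i_K` is `θ`-good**: some cluster in it has at least `2θK` vertices.
[cite: DuminilcopinGarbanTassion2024, §2.2 (θ-good blocks)] -/
def good (K : ℕ) (θ : ℝ) (i : ℤ) : Set (BondConfig ℤ) :=
  {ω | ∃ x ∈ blk K i, 2 * θ * K ≤ ((blkCluster ω K i x).card : ℝ)}

/-- **`B^i_K` is `θ`-bad**: it is not `θ`-good; `p_{β,λ}(K, θ)` is the probability of `bad K θ 0`.
[cite: DuminilcopinGarbanTassion2024, §2.2 (θ-bad blocks, p(K,θ))] -/
def bad (K : ℕ) (θ : ℝ) (i : ℤ) : Set (BondConfig ℤ) := (good K θ i)ᶜ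

/-- Goodness is monotone in the density parameter: `θ'`-bad implies `θ`-bad for `θ' ≤ θ`.
[folklore] -/
theorem good_mono {K : ℕ} {θ θ' : ℝ} (h : θ' ≤ θ) (i : ℤ) : good K θ i ⊆ good K θ' i := by
  rintro ω ⟨x, hx, hcard⟩
  refine ⟨x, hx, le_trans ?_ hcard⟩
  have : (0 : ℝ) ≤ K := Nat.cast_nonneg K
  nlinarith

/-- `good K θ i` only looks at the edges inside the block. [folklore] -/
theorem good_inter_eq {K : ℕ} {θ : ℝ} {i : ℤ} {F : Set (Sym2 ℤ)} (hF : blkEdges K i ⊆ F)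
    (ω : BondConfig ℤ) : ω ∩ F ∈ good K θ i ↔ ω ∈ good K θ i := by
  simp only [good, Set.mem_setOf_eq, blkCluster, locCluster_inter_eq hF]

/-- `good K θ i` is determined by the (finitely many) edges inside the block.
[cite: DuminilcopinGarbanTassion2024, §2.3 ("By independence")] -/
theorem determinedBy_good (K : ℕ) (θ : ℝ) (i : ℤ) : DeterminedBy (good K θ i) (blkEdges K i) := by
  rw [determinedBy_iff]
  intro ω ω' h
  rw [← good_inter_eq subset_rfl ω, h, good_inter_eq subset_rfl ω']

/-- `bad K θ i` is determined by the edges inside the block. [folklore] -/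
theorem determinedBy_bad (K : ℕ) (θ : ℝ) (i : ℤ) : DeterminedBy (bad K θ i) (blkEdges K i) := by
  have h := determinedBy_good K θ i
  rw [determinedBy_iff] at h ⊢
  intro ω ω' hω
  rw [bad, Set.mem_compl_iff, Set.mem_compl_iff, h ω ω' hω]

/-- `good K θ i` is measurable (a local event). [folklore] -/
theorem measurableSet_good (K : ℕ) (θ : ℝ) (i : ℤ) : MeasurableSet (good K θ i) := by
  have h := determinedBy_good K θ i
  rw [← (blkEdges_finite K i).coe_toFinset] at h
  exact h.measurableSet_of_finset

/-- `bad K θ i` is measurable. [folklore] -/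
theorem measurableSet_bad (K : ℕ) (θ : ℝ) (i : ℤ) : MeasurableSet (bad K θ i) :=
  (measurableSet_good K θ i).compl

/-! ### Merging of big clusters of overlapping blocks -/

/-- A cluster of `B^i_K` with at least `2θK > 3K/2` vertices (`K ≥ 1`) has more than `K/2`
of them in the right half `[Ki, K(i+1))` of the block (the left half has only `K` sites), and
likewise more than `K/2` in the left half. Cardinality bookkeeping for the merging lemma.
[folklore] -/
theorem card_filter_half_gt {K : ℕ} (hK : 1 ≤ K) {θ : ℝ} (hθ : 3 / 4 < θ) {i : ℤ} {A : Finset ℤ}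
    (hA : A ⊆ blk K i) (hcard : 2 * θ * K ≤ (A.card : ℝ)) :
    K < 2 * (A.filter fun x => (K : ℤ) * i ≤ x).card ∧
      K < 2 * (A.filter fun x => x < (K : ℤ) * i).card := by
  have h3 : 3 * K < 2 * A.card := by
    have hKpos : (0 : ℝ) < K := by exact_mod_cast hK
    have : (3 * K : ℝ) < 2 * A.card := by nlinarith
    exact_mod_cast this
  -- the two halves
  have hsplit : A.card = (A.filter fun x => (K : ℤ) * i ≤ x).card +
      (A.filter fun x => x < (K : ℤ) * i).card := by
    rw [← Finset.card_filter_add_card_filter_not (fun x => (K : ℤ) * i ≤ x)]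
    congr 2
    ext x; simp [not_le]
  have hR : (A.filter fun x => (K : ℤ) * i ≤ x).card ≤ K := by
    calc (A.filter fun x => (K : ℤ) * i ≤ x).card
        ≤ (Finset.Ico ((K : ℤ) * i) ((K : ℤ) * (i + 1))).card := by
          refine Finset.card_le_card fun x hx => ?_
          rw [Finset.mem_filter] at hx
          have := mem_blk.1 (hA hx.1)
          rw [Finset.mem_Ico]; exact ⟨hx.2, this.2⟩
      _ = K := by rw [Int.card_Ico]; have : (K : ℤ) * (i + 1) - K * i = K := by ring
                  rw [this, Int.toNat_natCast]
  have hL : (A.filter fun x => x < (K : ℤ) * i).card ≤ K := by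
    calc (A.filter fun x => x < (K : ℤ) * i).card
        ≤ (Finset.Ico ((K : ℤ) * (i - 1)) ((K : ℤ) * i)).card := by
          refine Finset.card_le_card fun x hx => ?_
          rw [Finset.mem_filter] at hx
          have := mem_blk.1 (hA hx.1)
          rw [Finset.mem_Ico]; exact ⟨this.1, hx.2⟩
      _ = K := by rw [Int.card_Ico]; have : (K : ℤ) * i - K * (i - 1) = K := by ring
                  rw [this, Int.toNat_natCast]
  constructor <;> omega

/-- **Merging lemma.** If `θ > 3/4` and `x`, `x'` have clusters of size `≥ 2θK` in the
consecutive blocks `B^i_K`, `B^{i+1}_K`, then these two clusters share a vertex (both contain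
more than half of the `K` sites of the overlap `[Ki, K(i+1))`).
[cite: DuminilcopinGarbanTassion2024, §2.3 (proof of Lemma 2, "all the clusters 𝐂(B^j_K) are connected together")] -/
theorem exists_mem_blkCluster_inter {K : ℕ} (hK : 1 ≤ K) {θ : ℝ} (hθ : 3 / 4 < θ)
    {ω : BondConfig ℤ} {i : ℤ} {x x' : ℤ} (hx : 2 * θ * K ≤ ((blkCluster ω K i x).card : ℝ))
    (hx' : 2 * θ * K ≤ ((blkCluster ω K (i + 1) x').card : ℝ)) :
    ∃ z, z ∈ blkCluster ω K i x ∧ z ∈ blkCluster ω K (i + 1) x' := by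
  set A := blkCluster ω K i x with hA
  set B := blkCluster ω K (i + 1) x' with hB
  have h1 := (card_filter_half_gt hK hθ (locCluster_subset ω _ _ x) hx).1
  have h2 := (card_filter_half_gt hK hθ (locCluster_subset ω _ _ x') hx').2
  rw [show (K : ℤ) * (i + 1) = K * i + K by ring] at h2
  -- both filtered sets live in the overlap `[Ki, Ki + K)`, of cardinality `K`
  set A' := A.filter fun y => (K : ℤ) * i ≤ y
  set B' := B.filter fun y => y < (K : ℤ) * i + K
  have hsub : A' ∪ B' ⊆ Finset.Ico ((K : ℤ) * i) ((K : ℤ) * i + K) := by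
    intro y hy
    rw [Finset.mem_Ico]
    rcases Finset.mem_union.1 hy with hy | hy
    · rw [Finset.mem_filter] at hy
      have := mem_blk.1 (locCluster_subset ω _ _ x hy.1)
      exact ⟨hy.2, by linarith [this.2]⟩
    · rw [Finset.mem_filter] at hy
      have := mem_blk.1 (locCluster_subset ω _ _ x' hy.1)
      exact ⟨by linarith [this.1], hy.2⟩
  have hcardI : (Finset.Ico ((K : ℤ) * i) ((K : ℤ) * i + K)).card = K := by
    rw [Int.card_Ico, show (K : ℤ) * i + K - K * i = K by ring, Int.toNat_natCast]
  by_contra hne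
  push Not at hne
  have hdisj : Disjoint A' B' := by
    rw [Finset.disjoint_left]
    intro y hyA hyB
    exact hne y (Finset.mem_filter.1 hyA).1 (Finset.mem_filter.1 hyB).1
  have := Finset.card_le_card hsub
  rw [Finset.card_union_of_disjoint hdisj, hcardI] at this
  omega

/-! ### Chains of good blocks -/

/-- **Chain lemma.** Let the blocks `B^j_K`, `a ≤ j ≤ b`, carry clusters of size `≥ 2θK` at the
sites `x j` (`θ > 3/4`), and let the edge set `E` contain all edges inside these blocks. Then
all the `x j` are joined to `x a` by open edges of `E`.
[cite: DuminilcopinGarbanTassion2024, §2.3 (proof of Lemma 2, merging of consecutive good blocks)] -/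
theorem reachable_of_good_chain {K : ℕ} (hK : 1 ≤ K) {θ : ℝ} (hθ : 3 / 4 < θ)
    {ω : BondConfig ℤ} {E : Set (Sym2 ℤ)} {a b : ℤ} {x : ℤ → ℤ}
    (hE : ∀ j, a ≤ j → j ≤ b → blkEdges K j ⊆ E)
    (hx : ∀ j, a ≤ j → j ≤ b → 2 * θ * K ≤ ((blkCluster ω K j (x j)).card : ℝ)) :
    ∀ j, a ≤ j → j ≤ b → (openGraph (ω ∩ E)).Reachable (x a) (x j) := by
  intro j haj hjb
  induction j, haj using Int.leInduction with
  | base => exact Reachable.refl _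
  | succ j haj ih =>
    have hjb' : j ≤ b := by linarith
    obtain ⟨z, hz, hz'⟩ :=
      exists_mem_blkCluster_inter hK hθ (hx j haj hjb') (hx (j + 1) (by linarith) hjb)
    have h1 : (openGraph (ω ∩ E)).Reachable (x j) z :=
      (mem_locCluster.1 hz).2.mono (openGraph_mono (Set.inter_subset_inter_right _ (hE j haj hjb')))
    have h2 : (openGraph (ω ∩ E)).Reachable (x (j + 1)) z :=
      (mem_locCluster.1 hz').2.mono
        (openGraph_mono (Set.inter_subset_inter_right _ (hE (j + 1) (by linarith) hjb)))
    exact ((ih hjb').trans h1).trans h2.symm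

/-- Along a chain of good blocks, the cluster (through `E`, in any finite `S` containing the
blocks) of any site joined to `x a` contains every block cluster of the chain.
[cite: DuminilcopinGarbanTassion2024, §2.3 (proof of Lemma 2)] -/
theorem blkCluster_subset_locCluster_of_good_chain {K : ℕ} (hK : 1 ≤ K) {θ : ℝ}
    (hθ : 3 / 4 < θ) {ω : BondConfig ℤ} {E : Set (Sym2 ℤ)} {S : Finset ℤ} {a b : ℤ} {x : ℤ → ℤ}
    (hE : ∀ j, a ≤ j → j ≤ b → blkEdges K j ⊆ E) (hS : ∀ j, a ≤ j → j ≤ b → blk K j ⊆ S)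
    (hx : ∀ j, a ≤ j → j ≤ b → 2 * θ * K ≤ ((blkCluster ω K j (x j)).card : ℝ))
    {y : ℤ} (hy : (openGraph (ω ∩ E)).Reachable y (x a)) {j : ℤ} (haj : a ≤ j) (hjb : j ≤ b) :
    blkCluster ω K j (x j) ⊆ locCluster ω E S y := by
  intro z hz
  rw [mem_locCluster] at hz ⊢
  refine ⟨hS j haj hjb hz.1, (hy.trans (reachable_of_good_chain hK hθ hE hx j haj hjb)).trans ?_⟩
  exact hz.2.mono (openGraph_mono (Set.inter_subset_inter_right _ (hE j haj hjb)))

/-- **Size of the merged cluster.** In the situation of the chain lemma, the cluster of `y`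
contains the pairwise disjoint big clusters of the blocks `B^{a+2m}_K`, `m < N` (all inside
`[a, b]`), hence has at least `N · 2θK` vertices.
[cite: DuminilcopinGarbanTassion2024, §2.3 (proof of Lemma 2, "a cluster in B_{CK} with cardinality larger than 2θCK")] -/
theorem card_locCluster_ge_of_good_chain {K : ℕ} (hK : 1 ≤ K) {θ : ℝ} (hθ : 3 / 4 < θ)
    {ω : BondConfig ℤ} {E : Set (Sym2 ℤ)} {S : Finset ℤ} {a b : ℤ} {x : ℤ → ℤ}
    (hE : ∀ j, a ≤ j → j ≤ b → blkEdges K j ⊆ E) (hS : ∀ j, a ≤ j → j ≤ b → blk K j ⊆ S)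
    (hx : ∀ j, a ≤ j → j ≤ b → 2 * θ * K ≤ ((blkCluster ω K j (x j)).card : ℝ))
    {y : ℤ} (hy : (openGraph (ω ∩ E)).Reachable y (x a)) {N : ℕ} (hN : a + 2 * ((N : ℤ) - 1) ≤ b) :
    (N : ℝ) * (2 * θ * K) ≤ ((locCluster ω E S y).card : ℝ) := by
  -- the disjoint union of the big clusters of the blocks `a + 2m`, `m < N`
  set f : ℕ → Finset ℤ := fun m => blkCluster ω K (a + 2 * m) (x (a + 2 * m)) with hf
  have hsub : (Finset.range N).biUnion f ⊆ locCluster ω E S y := by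
    intro z hz
    obtain ⟨m, hm, hzm⟩ := Finset.mem_biUnion.1 hz
    have hm' : (m : ℤ) ≤ N - 1 := by
      have := Finset.mem_range.1 hm; omega
    exact blkCluster_subset_locCluster_of_good_chain hK hθ hE hS hx hy (by linarith) (by linarith)
      hzm
  have hdisj : ((Finset.range N : Finset ℕ) : Set ℕ).PairwiseDisjoint f := by
    intro m _ m' _ hmm'
    rw [Function.onFun]
    refine Finset.disjoint_of_subset_left (locCluster_subset ω _ _ _)
      (Finset.disjoint_of_subset_right (locCluster_subset ω _ _ _) ?_)
    rcases lt_or_gt_of_ne hmm' with h | h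
    · exact disjoint_blk (by linarith)
    · exact (disjoint_blk (by linarith)).symm
  calc (N : ℝ) * (2 * θ * K) = ∑ _m ∈ Finset.range N, 2 * θ * K := by
        rw [Finset.sum_const, Finset.card_range, nsmul_eq_mul]
    _ ≤ ∑ m ∈ Finset.range N, ((f m).card : ℝ) := by
        refine Finset.sum_le_sum fun m hm => ?_
        have hm' : (m : ℤ) ≤ N - 1 := by
          have := Finset.mem_range.1 hm; omega
        exact hx (a + 2 * m) (by linarith) (by linarith)
    _ = (((Finset.range N).biUnion f).card : ℝ) := by
        rw [Finset.card_biUnion hdisj]; push_cast; rfl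
    _ ≤ ((locCluster ω E S y).card : ℝ) := by exact_mod_cast Finset.card_le_card hsub

end Literature.Probability.Percolation

end
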